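import Literature.Analysis.Complex.LengthAreaDiameter
import HarnessLib

/-!
# Log-scale length–area: few circles have images crossing a thin conformal annulus

Topic: Analysis / Complex (support for the conformal boundary-hitting estimate of
Lawler–Schramm–Werner, *Conformal invariance of planar loop-erased random walks and uniform
spanning trees*, Ann. Probab. **32** (2004), Lemma 5.4, in the tree's Brownian-motion-free
rendering). Let `g` be holomorphic and injective on an open set `U ⊆ ℂ`, fix two centres `p ∈ ℂ`
(of concentric circles `{|z - p| = u}`) and `c ∈ ℂ` (of the "conformal" discs `{|w - c| < r}` in
the image), and two radii `0 < η` and `ε ≥ 2^K η`. Suppose that for every `u` in a set of radii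
`T ⊆ (0, ∞)` the circle `{|z - p| = u}` contains an arc lying in `U` whose image under `g` joins
the small disc `{|w - c| ≤ η}` to the exterior `{|w - c| ≥ ε}`. Then

  `∫_T du / u ≤ 8 π² / K`                  (`lintegral_inv_le_of_crossings`).

In words: the logarithmic measure of the set of circles about `p` whose images cross the annulus
`{η < |w - c| < ε}` is `O(1 / log (ε/η))`. (For `g` a conformal map of a simply connected domain
onto the unit disc this is the statement "curves of bounded extremal distance cannot all reach
conformally far", which in [LSW04], proof of Lemma 5.4, is obtained from the conformal invariance
of the harmonic measure of Brownian motion; here it is pure length–area.)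

## Proof (Pommerenke's length–area on dyadic shells, with a harmonic-mean Cauchy–Schwarz)

Put `r_k = 2^k η` and `U_k = U ∩ g⁻¹(B(c, r_{k+1}))`, `k < K`, so that
`area g(U_k) ≤ π r_{k+1}² = 4π 4^k η²`. Fix `u ∈ T` and the crossing arc `t ↦ p + u e^{it}`,
`t ∈ [a, b]`, `b ≤ a + 2π`. Selecting first passages (`exists_shells`) gives pairwise disjoint
parameter intervals `I_k = (s_k, t_k) ⊆ (a, b)`, `k < K`, on which the image stays in
`B(c, r_{k+1})` and across which it travels from `{|w - c| ≤ r_k}` to `{|w - c| ≥ r_{k+1}}`, a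
distance `≥ r_k`. By the fundamental theorem of calculus and Cauchy–Schwarz on `I_k`
(`sq_le_mul_setLIntegral`), `r_k² ≤ u² |I_k| ∫_{I_k} ‖g'‖²`, whence, with `A_k(u)` the angular
integral of `‖g'‖² 1_{U_k}` over the full circle,
`∑_k A_k(u)/4^k ≥ (η²/u²) ∑_k 1/|I_k| ≥ (η²/u²) K² / ∑_k |I_k| ≥ η² K² / (2π u²)`
(harmonic–arithmetic mean; `∑ |I_k| ≤ b - a ≤ 2π`). Multiplying by `u`, integrating over `T` and
using the area formula in polar coordinates (`LengthArea.lintegral_angSqAt_eq_volume`),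
`(η² K² / 2π) ∫_T du/u ≤ ∑_k 4^{-k} area g(U_k) ≤ 4π η² K`.

Everything is proved; the only inputs are the tree's `LengthAreaDiameter.lean` (polar area
formula, angular integrals) and Mathlib's fundamental theorem of calculus.

## References

* Ch. Pommerenke, *Boundary Behaviour of Conformal Maps*, Springer (1992), Prop. 2.2
  (length–area). [PommerenkeBBCM1992]
* G. F. Lawler, O. Schramm, W. Werner, Ann. Probab. 32 (2004), Lemma 5.4.
  [LawlerSchrammWerner2004]
-/

noncomputable section

open Set Filter Metric MeasureTheory Real
open _root_.Complex _root_.Topology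
open scoped ENNReal NNReal

namespace Literature.Analysis.Complex

namespace LogScaleLengthArea

open LengthArea

/-! ### Set integrals of periodic functions over one period -/

/-- Translation of a set integral over an interval `(u, v]`. [folklore] -/
theorem setLIntegral_Ioc_comp_add (h : ℝ → ℝ≥0∞) (u v T : ℝ) :
    ∫⁻ x in Ioc u v, h (x + T) = ∫⁻ x in Ioc (u + T) (v + T), h x := by
  rw [← lintegral_indicator measurableSet_Ioc, ← lintegral_indicator measurableSet_Ioc]
  have hind : (fun x ↦ (Ioc u v).indicator (fun x ↦ h (x + T)) x) =
      fun x ↦ (Ioc (u + T) (v + T)).indicator h (x + T) := by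
    funext x
    by_cases hx : x ∈ Ioc u v
    · rw [indicator_of_mem hx,
        indicator_of_mem (show x + T ∈ Ioc (u + T) (v + T) from
          ⟨by linarith [hx.1], by linarith [hx.2]⟩)]
    · rw [indicator_of_notMem hx, indicator_of_notMem]
      exact fun h' ↦ hx ⟨by linarith [h'.1], by linarith [h'.2]⟩
  rw [hind, lintegral_add_right_eq_self]

/-- **A `T`-periodic function has the same integral over the windows `(θ₀, θ₀ + T]` and
`(θ₁, θ₁ + T]`** for `θ₀ ≤ θ₁ ≤ θ₀ + T`. [folklore] -/
theorem setLIntegral_Ioc_eq_of_periodic {h : ℝ → ℝ≥0∞} {T : ℝ} (hper : ∀ x, h (x + T) = h x)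
    {θ₀ θ₁ : ℝ} (h01 : θ₀ ≤ θ₁) (h10 : θ₁ ≤ θ₀ + T) :
    ∫⁻ x in Ioc θ₁ (θ₁ + T), h x = ∫⁻ x in Ioc θ₀ (θ₀ + T), h x := by
  have hdisj : ∀ a b d : ℝ, Disjoint (Ioc a b) (Ioc b d) := fun a b d ↦
    disjoint_left.2 fun x hx hx' ↦ (not_lt.2 hx.2) hx'.1
  have hsplit1 : ∫⁻ x in Ioc θ₀ (θ₀ + T), h x =
      (∫⁻ x in Ioc θ₀ θ₁, h x) + ∫⁻ x in Ioc θ₁ (θ₀ + T), h x := by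
    rw [← Ioc_union_Ioc_eq_Ioc h01 h10, lintegral_union measurableSet_Ioc (hdisj _ _ _)]
  have hsplit2 : ∫⁻ x in Ioc θ₁ (θ₁ + T), h x =
      (∫⁻ x in Ioc θ₁ (θ₀ + T), h x) + ∫⁻ x in Ioc (θ₀ + T) (θ₁ + T), h x := by
    rw [← Ioc_union_Ioc_eq_Ioc h10 (by linarith), lintegral_union measurableSet_Ioc (hdisj _ _ _)]
  have hshift : ∫⁻ x in Ioc (θ₀ + T) (θ₁ + T), h x = ∫⁻ x in Ioc θ₀ θ₁, h x := by
    rw [← setLIntegral_Ioc_comp_add h θ₀ θ₁ T]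
    simp_rw [hper]
  rw [hsplit1, hsplit2, hshift, add_comm]

/-- **The angular integral `angSqAt` may be computed over any window of length `2π`** starting
in `[-π, π]`. [folklore] -/
theorem angSqAt_eq_setLIntegral_Ioc (U : Set ℂ) (f : ℂ → ℂ) (p : ℂ) (r : ℝ) {θ : ℝ}
    (hθ : θ ∈ Icc (-π) π) :
    angSqAt U f p r = ∫⁻ t in Ioc θ (θ + 2 * π), sqDerOn U f (circleMap p r t) := by
  have hper : ∀ t, sqDerOn U f (circleMap p r (t + 2 * π)) = sqDerOn U f (circleMap p r t) :=
    fun t ↦ by rw [periodic_circleMap]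
  have key := setLIntegral_Ioc_eq_of_periodic (h := fun t ↦ sqDerOn U f (circleMap p r t))
    (T := 2 * π) hper (θ₀ := -π) (θ₁ := θ) hθ.1 (by linarith [hθ.2])
  rw [key, show -π + 2 * π = π by ring, angSqAt]
  exact setLIntegral_congr Ioo_ae_eq_Ioc

/-! ### The fundamental theorem of calculus on an interval -/

/-- **`‖γ t - γ s‖ ≤ ∫_s^t ‖γ'‖`** for a path continuous on `[s, t]` and differentiable on
`(s, t)` (no integrability hypothesis: if the right-hand side is infinite there is nothing to
prove). [folklore] -/
theorem enorm_sub_le_lintegral_deriv_Ioo {γ : ℝ → ℂ} {s t : ℝ} (hst : s ≤ t)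
    (hc : ContinuousOn γ (Icc s t)) (hd : ∀ x ∈ Ioo s t, DifferentiableAt ℝ γ x) :
    ‖γ t - γ s‖ₑ ≤ ∫⁻ x in Ioo s t, ‖deriv γ x‖ₑ := by
  by_cases htop : ∫⁻ x in Ioo s t, ‖deriv γ x‖ₑ = ∞
  · rw [htop]; exact le_top
  have hint : IntegrableOn (deriv γ) (Ioo s t) :=
    ⟨(measurable_deriv γ).aestronglyMeasurable, lt_top_iff_ne_top.2 htop⟩
  have hint' : IntervalIntegrable (deriv γ) volume s t :=
    (intervalIntegrable_iff_integrableOn_Ioo_of_le hst).2 hint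
  have hftc := intervalIntegral.integral_eq_sub_of_hasDerivAt_of_le hst hc
    (fun x hx ↦ (hd x hx).hasDerivAt) hint'
  have hle : ‖γ t - γ s‖ ≤ (∫⁻ x in Ioo s t, ‖deriv γ x‖ₑ).toReal := by
    rw [← hftc, intervalIntegral.integral_of_le hst, integral_Ioc_eq_integral_Ioo,
      ← integral_norm_eq_lintegral_enorm hint.aestronglyMeasurable]
    exact norm_integral_le_integral_norm _
  calc ‖γ t - γ s‖ₑ = ENNReal.ofReal ‖γ t - γ s‖ := (ofReal_norm _).symm
    _ ≤ ENNReal.ofReal ((∫⁻ x in Ioo s t, ‖deriv γ x‖ₑ).toReal) := ENNReal.ofReal_le_ofReal hle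
    _ ≤ ∫⁻ x in Ioo s t, ‖deriv γ x‖ₑ := ENNReal.ofReal_toReal_le

/-! ### Selecting the dyadic shells along a path -/

/-- **First passages through increasing levels.** Let `φ` be continuous on `[a, b]` with
`φ a ≤ r 0` and `r K ≤ φ b` for levels `r 0 < r 1 < ⋯`. Then there are parameter intervals
`(s k, t k) ⊆ (a, b)`, `k < K`, ordered increasingly (`t k ≤ s (k+1)`), with `φ (s k) ≤ r k`,
`r (k+1) ≤ φ (t k)` and `φ < r (k+1)` on `[a, t k)`. (`t k` is the first passage of the level
`r (k+1)`, `s k` the last visit below `r k` before it.) [folklore] -/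
theorem exists_shells {φ : ℝ → ℝ} {a b : ℝ} (hab : a ≤ b) (hφ : ContinuousOn φ (Icc a b))
    {r : ℕ → ℝ} (hr : ∀ k, r k < r (k + 1)) {K : ℕ} (ha : φ a ≤ r 0) (hb : r K ≤ φ b) :
    ∃ s t : ℕ → ℝ, ∀ k < K, a ≤ s k ∧ s k < t k ∧ t k ≤ b ∧ φ (s k) ≤ r k ∧ r (k + 1) ≤ φ (t k) ∧
      (∀ x ∈ Ico a (t k), φ x < r (k + 1)) ∧ (k + 1 < K → t k ≤ s (k + 1)) := by
  have hrmono : Monotone r := monotone_nat_of_le_succ fun k ↦ (hr k).le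
  -- the closed level sets
  have hclosed_ge : ∀ C : ℝ, IsClosed {x ∈ Icc a b | C ≤ φ x} := fun C ↦
    hφ.preimage_isClosed_of_isClosed isClosed_Icc (isClosed_Ici (a := C))
  have hclosed_le : ∀ C d : ℝ, IsClosed {x ∈ Icc a d | φ x ≤ C ∧ x ≤ b} := fun C d ↦ by
    have h1 := hφ.preimage_isClosed_of_isClosed isClosed_Icc (isClosed_Iic (a := C))
    have : {x ∈ Icc a d | φ x ≤ C ∧ x ≤ b} = (Icc a b ∩ φ ⁻¹' Iic C) ∩ Iic d := by
      ext x
      simp only [mem_setOf_eq, mem_inter_iff, mem_Icc, mem_preimage, mem_Iic]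
      constructor
      · rintro ⟨⟨h1, h2⟩, h3, h4⟩; exact ⟨⟨⟨h1, h4⟩, h3⟩, h2⟩
      · rintro ⟨⟨⟨h1, h4⟩, h3⟩, h2⟩; exact ⟨⟨h1, h2⟩, h3, h4⟩
    rw [this]
    exact h1.inter isClosed_Iic
  -- first passages
  set t : ℕ → ℝ := fun k ↦ sInf {x ∈ Icc a b | r (k + 1) ≤ φ x} with ht_def
  set s : ℕ → ℝ := fun k ↦ sSup {x ∈ Icc a (t k) | φ x ≤ r k ∧ x ≤ b} with hs_def
  -- properties of `t k` for `k < K`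
  have htk : ∀ k < K, t k ∈ Icc a b ∧ r (k + 1) ≤ φ (t k) ∧
      ∀ x ∈ Ico a (t k), φ x < r (k + 1) := by
    intro k hk
    have hbA : b ∈ {x ∈ Icc a b | r (k + 1) ≤ φ x} :=
      ⟨right_mem_Icc.2 hab, (hrmono (Nat.succ_le_of_lt hk)).trans hb⟩
    have hbdd : BddBelow {x ∈ Icc a b | r (k + 1) ≤ φ x} := ⟨a, fun x hx ↦ hx.1.1⟩
    have hmem : t k ∈ {x ∈ Icc a b | r (k + 1) ≤ φ x} :=
      (hclosed_ge (r (k + 1))).csInf_mem ⟨b, hbA⟩ hbdd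
    refine ⟨hmem.1, hmem.2, fun x hx ↦ ?_⟩
    by_contra hge
    have hxA : x ∈ {x ∈ Icc a b | r (k + 1) ≤ φ x} :=
      ⟨⟨hx.1, hx.2.le.trans hmem.1.2⟩, not_lt.1 hge⟩
    exact (not_le.2 hx.2) (csInf_le hbdd hxA)
  -- `a < t k` and `φ (t k) ≤ r (k+1)` (continuity from the left)
  have htk' : ∀ k < K, a < t k ∧ φ (t k) ≤ r (k + 1) := by
    intro k hk
    obtain ⟨hmem, hge, hlt⟩ := htk k hk
    have hat : a < t k := by
      rcases eq_or_lt_of_le hmem.1 with h | h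
      · exfalso
        have : φ a < r (k + 1) := ha.trans_lt ((hrmono (Nat.zero_le k)).trans_lt (hr k))
        rw [h] at this
        exact (not_le.2 this) hge
      · exact h
    refine ⟨hat, ?_⟩
    have hsub : Ico a (t k) ⊆ {x ∈ Icc a b | φ x ≤ r (k + 1) ∧ x ≤ b} := fun x hx ↦
      ⟨⟨hx.1, hx.2.le.trans hmem.2⟩, (hlt x hx).le, hx.2.le.trans hmem.2⟩
    have hcl : t k ∈ closure (Ico a (t k)) := by
      rw [closure_Ico hat.ne]; exact right_mem_Icc.2 hat.le
    exact ((hclosed_le (r (k + 1)) b).closure_subset_iff.2 hsub hcl).2.1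
  -- properties of `s k`
  have hsk : ∀ k < K, s k ∈ Icc a (t k) ∧ φ (s k) ≤ r k ∧
      ∀ x, x ∈ Icc a (t k) → φ x ≤ r k → x ≤ b → x ≤ s k := by
    intro k hk
    obtain ⟨hmem, -, -⟩ := htk k hk
    have haB : a ∈ {x ∈ Icc a (t k) | φ x ≤ r k ∧ x ≤ b} :=
      ⟨left_mem_Icc.2 hmem.1, ha.trans (hrmono (Nat.zero_le k)), hab⟩
    have hbdd : BddAbove {x ∈ Icc a (t k) | φ x ≤ r k ∧ x ≤ b} := ⟨t k, fun x hx ↦ hx.1.2⟩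
    have hmemB : s k ∈ {x ∈ Icc a (t k) | φ x ≤ r k ∧ x ≤ b} :=
      (hclosed_le (r k) (t k)).csSup_mem ⟨a, haB⟩ hbdd
    exact ⟨hmemB.1, hmemB.2.1, fun x hx hφx hxb ↦ le_csSup hbdd ⟨hx, hφx, hxb⟩⟩
  refine ⟨s, t, fun k hk ↦ ?_⟩
  obtain ⟨htmem, hge, hlt⟩ := htk k hk
  obtain ⟨-, hφt⟩ := htk' k hk
  obtain ⟨hsmem, hφs, -⟩ := hsk k hk
  have hst : s k < t k := by
    rcases eq_or_lt_of_le hsmem.2 with h | h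
    · exfalso
      have : φ (s k) < φ (t k) := hφs.trans_lt ((hr k).trans_le hge)
      rw [h] at this
      exact lt_irrefl _ this
    · exact h
  refine ⟨hsmem.1, hst, htmem.2, hφs, hge, hlt, fun hk1 ↦ ?_⟩
  -- `t k ≤ s (k+1)`: `t k` is a candidate for the supremum defining `s (k+1)`
  obtain ⟨-, -, hsmax1⟩ := hsk (k + 1) hk1
  have hbdd0 : BddBelow {x ∈ Icc a b | r (k + 1) ≤ φ x} := ⟨a, fun y hy ↦ hy.1.1⟩
  have htt : t k ≤ t (k + 1) := by
    refine le_csInf ⟨b, ⟨right_mem_Icc.2 hab, (hrmono (Nat.succ_le_of_lt hk1)).trans hb⟩⟩ ?_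
    rintro x ⟨hx, hφx⟩
    exact csInf_le hbdd0 ⟨hx, (hr (k + 1)).le.trans hφx⟩
  exact hsmax1 (t k) ⟨htmem.1, htt⟩ hφt htmem.2

/-- The same selection for a path travelling the other way (`r K ≤ φ a`, `φ b ≤ r 0`): intervals
ordered decreasingly, with `φ (t k) ≤ r k`, `r (k+1) ≤ φ (s k)` and `φ < r (k+1)` on `(s k, b]`.
[folklore] -/
theorem exists_shells_rev {φ : ℝ → ℝ} {a b : ℝ} (hab : a ≤ b) (hφ : ContinuousOn φ (Icc a b))
    {r : ℕ → ℝ} (hr : ∀ k, r k < r (k + 1)) {K : ℕ} (ha : r K ≤ φ a) (hb : φ b ≤ r 0) :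
    ∃ s t : ℕ → ℝ, ∀ k < K, a ≤ s k ∧ s k < t k ∧ t k ≤ b ∧ φ (t k) ≤ r k ∧ r (k + 1) ≤ φ (s k) ∧
      (∀ x ∈ Ioc (s k) b, φ x < r (k + 1)) ∧ (k + 1 < K → t (k + 1) ≤ s k) := by
  -- reflect the parameter: `ψ y = φ (a + b - y)`
  set ψ : ℝ → ℝ := fun y ↦ φ (a + b - y) with hψ
  have hmaps : MapsTo (fun y : ℝ ↦ a + b - y) (Icc a b) (Icc a b) := fun y hy ↦
    ⟨by linarith [hy.2], by linarith [hy.1]⟩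
  have hψc : ContinuousOn ψ (Icc a b) := hφ.comp (by fun_prop) hmaps
  have hψa : ψ a ≤ r 0 := by simp only [hψ, add_sub_cancel_left]; exact hb
  have hψb : r K ≤ ψ b := by simp only [hψ, add_sub_cancel_right]; exact ha
  obtain ⟨s', t', h⟩ := exists_shells hab hψc hr hψa hψb
  refine ⟨fun k ↦ a + b - t' k, fun k ↦ a + b - s' k, fun k hk ↦ ?_⟩
  obtain ⟨h1, h2, h3, h4, h5, h6, h7⟩ := h k hk
  refine ⟨by linarith, by linarith, by linarith, ?_, ?_, fun x hx ↦ ?_, fun hk1 ↦ ?_⟩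
  · simpa [hψ] using h4
  · simpa [hψ] using h5
  · have := h6 (a + b - x) ⟨by linarith [hx.2], by linarith [hx.1]⟩
    simp only [hψ] at this
    rwa [show a + b - (a + b - x) = x by ring] at this
  · have := h7 hk1
    show a + b - s' (k + 1) ≤ a + b - t' k
    linarith

/-! ### One shell: `r_k² ≤ u² |I| ∫_I ‖g'‖²` -/

section OneShell

variable {U : Set ℂ} {g : ℂ → ℂ}

/-- **Cauchy–Schwarz on a parameter interval**: `(∫_I G)² ≤ |I| ∫_I G²`. [folklore] -/
theorem setLIntegral_sq_le {G : ℝ → ℝ≥0∞} (hG : Measurable G) (s t : ℝ) :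
    (∫⁻ x in Ioo s t, G x) ^ 2 ≤ ENNReal.ofReal (t - s) * ∫⁻ x in Ioo s t, G x ^ 2 := by
  set μ : Measure ℝ := volume.restrict (Ioo s t) with hμ
  have h := ENNReal.lintegral_mul_le_Lp_mul_Lq μ Real.HolderConjugate.two_two hG.aemeasurable
    (g := fun _ ↦ 1) aemeasurable_const
  simp only [Pi.mul_apply, mul_one, lintegral_const, ENNReal.rpow_two, one_pow, one_mul] at h
  have hvol : μ univ = ENNReal.ofReal (t - s) := by
    rw [hμ, Measure.restrict_apply_univ, Real.volume_Ioo]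
  rw [hvol] at h
  calc (∫⁻ x in Ioo s t, G x) ^ 2 = (∫⁻ a, G a ∂μ) ^ 2 := rfl
    _ ≤ ((∫⁻ a, G a ^ 2 ∂μ) ^ (1 / 2 : ℝ) * ENNReal.ofReal (t - s) ^ (1 / 2 : ℝ)) ^ 2 := by
      gcongr
    _ = ENNReal.ofReal (t - s) * ∫⁻ a, G a ^ 2 ∂μ := by
      rw [← ENNReal.mul_rpow_of_nonneg _ _ (by norm_num : (0 : ℝ) ≤ 1 / 2), ← ENNReal.rpow_two,
        ← ENNReal.rpow_mul]
      norm_num [mul_comm]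

/-- **The crossing of one shell.** Along the arc `x ↦ p + u e^{ix}`, `x ∈ [s, t]`, lying in the
open set `U` on which `g` is holomorphic, with the open sub-arc over `(s, t)` lying in the open
set `W`: if the image travels between the spheres `{|w - c| = ρ₁}` and `{|w - c| = ρ₂}`
(`ρ₁ ≤ ρ₂`, in either direction), then `(ρ₂ - ρ₁)² ≤ u² (t - s) ∫_{(s,t)} ‖g'‖² 1_W`.
[cite: PommerenkeBBCM1992, Prop. 2.2] -/
theorem sq_le_mul_setLIntegral (hU : IsOpen U) (hg : DifferentiableOn ℂ g U) {W : Set ℂ}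
    (hW : IsOpen W) {p c : ℂ} {u : ℝ} (hu : 0 < u) {s t : ℝ} (hst : s ≤ t)
    (hmem : ∀ x ∈ Icc s t, circleMap p u x ∈ U) (hmemW : ∀ x ∈ Ioo s t, circleMap p u x ∈ W)
    {ρ₁ ρ₂ : ℝ} (hρ : ρ₁ ≤ ρ₂)
    (hends : (‖g (circleMap p u s) - c‖ ≤ ρ₁ ∧ ρ₂ ≤ ‖g (circleMap p u t) - c‖) ∨
      (‖g (circleMap p u t) - c‖ ≤ ρ₁ ∧ ρ₂ ≤ ‖g (circleMap p u s) - c‖)) :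
    ENNReal.ofReal ((ρ₂ - ρ₁) ^ 2) ≤
      ENNReal.ofReal (u ^ 2 * (t - s)) * ∫⁻ x in Ioo s t, sqDerOn W g (circleMap p u x) := by
  set γ : ℝ → ℂ := fun x ↦ g (circleMap p u x) with hγ
  -- continuity and differentiability of `γ`
  have hγc : ContinuousOn γ (Icc s t) :=
    hg.continuousOn.comp (continuous_circleMap p u).continuousOn hmem
  have hγd : ∀ x ∈ Ioo s t,
      HasDerivAt γ (deriv g (circleMap p u x) * (circleMap 0 u x * I)) x := by
    intro x hx
    have hxU : circleMap p u x ∈ U := hmem x (Ioo_subset_Icc_self hx)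
    have h1 : HasDerivAt g (deriv g (circleMap p u x)) (circleMap p u x) :=
      ((hg _ hxU).differentiableAt (hU.mem_nhds hxU)).hasDerivAt
    exact h1.comp x (hasDerivAt_circleMap p u x)
  -- the displacement
  have hdisp : ENNReal.ofReal (ρ₂ - ρ₁) ≤ ‖γ t - γ s‖ₑ := by
    rw [← ofReal_norm]
    apply ENNReal.ofReal_le_ofReal
    rcases hends with ⟨h1, h2⟩ | ⟨h1, h2⟩
    · have := norm_sub_norm_le (g (circleMap p u t) - c) (g (circleMap p u s) - c)
      rw [sub_sub_sub_cancel_right] at this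
      simp only [hγ]; linarith
    · have := norm_sub_norm_le (g (circleMap p u s) - c) (g (circleMap p u t) - c)
      rw [sub_sub_sub_cancel_right, norm_sub_rev (g (circleMap p u s)) (g (circleMap p u t))]
        at this
      simp only [hγ]; linarith
  -- the length of the image arc
  have hlen : ‖γ t - γ s‖ₑ ≤ ENNReal.ofReal u * ∫⁻ x in Ioo s t, derOn W g (circleMap p u x) := by
    refine (enorm_sub_le_lintegral_deriv_Ioo hst hγc fun x hx ↦ (hγd x hx).differentiableAt).trans ?_
    rw [← lintegral_const_mul' _ _ ENNReal.ofReal_ne_top]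
    refine setLIntegral_mono' measurableSet_Ioo fun x hx ↦ ?_
    rw [(hγd x hx).deriv, derOn, indicator_of_mem (hmemW x hx), ← ofReal_norm,
      ← ENNReal.ofReal_mul hu.le]
    apply ENNReal.ofReal_le_ofReal
    rw [norm_mul, norm_mul, norm_circleMap_zero, Complex.norm_I, mul_one, abs_of_pos hu]
    linarith [norm_nonneg (deriv g (circleMap p u x))]
  -- Cauchy–Schwarz
  have hmeasG : Measurable fun x ↦ derOn W g (circleMap p u x) :=
    (measurable_derOn hW g).comp (continuous_circleMap p u).measurable
  have hCS := setLIntegral_sq_le hmeasG s t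
  simp only [derOn_sq] at hCS
  -- combine
  have h2 := pow_le_pow_left' (hdisp.trans hlen) 2
  rw [← ENNReal.ofReal_pow (by linarith), mul_pow, ← ENNReal.ofReal_pow hu.le] at h2
  refine h2.trans ?_
  rw [ENNReal.ofReal_mul (pow_nonneg hu.le 2), mul_assoc]
  gcongr

end OneShell

/-! ### The harmonic–arithmetic mean step -/

/-- **`K² ≤ (∑ 1/x_k)(∑ x_k)`** for positive reals (Cauchy–Schwarz). [folklore] -/
theorem sq_card_le_sum_inv_mul_sum {K : ℕ} {x : ℕ → ℝ} (hx : ∀ k < K, 0 < x k) :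
    (K : ℝ) ^ 2 ≤ (∑ k ∈ Finset.range K, (x k)⁻¹) * ∑ k ∈ Finset.range K, x k := by
  have h := Finset.sum_mul_sq_le_sq_mul_sq (Finset.range K) (fun k ↦ (Real.sqrt (x k))⁻¹)
    (fun k ↦ Real.sqrt (x k))
  have hK : ∑ k ∈ Finset.range K, (Real.sqrt (x k))⁻¹ * Real.sqrt (x k) = K := by
    rw [Finset.sum_eq_card_nsmul (b := (1 : ℝ)) fun k hk ↦ inv_mul_cancel₀
      (Real.sqrt_pos.2 (hx k (Finset.mem_range.1 hk))).ne', Finset.card_range, nsmul_eq_mul,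
      mul_one]
  have h1 : ∑ k ∈ Finset.range K, (Real.sqrt (x k))⁻¹ ^ 2 = ∑ k ∈ Finset.range K, (x k)⁻¹ :=
    Finset.sum_congr rfl fun k hk ↦ by
      rw [inv_pow, Real.sq_sqrt (hx k (Finset.mem_range.1 hk)).le]
  have h2 : ∑ k ∈ Finset.range K, Real.sqrt (x k) ^ 2 = ∑ k ∈ Finset.range K, x k :=
    Finset.sum_congr rfl fun k hk ↦ by rw [Real.sq_sqrt (hx k (Finset.mem_range.1 hk)).le]
  rw [hK, h1, h2] at h
  exact h

/-- **Pairwise disjoint sub-intervals of an interval of length `L` have total length `≤ L`.**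
[folklore] -/
theorem sum_sub_le_of_disjoint {K : ℕ} {s t : ℕ → ℝ} {a L : ℝ} (hL : 0 ≤ L)
    (hst : ∀ k < K, s k ≤ t k) (hsub : ∀ k < K, Ioo (s k) (t k) ⊆ Ioc a (a + L))
    (hdisj : ∀ j < K, ∀ k < K, j ≠ k → Disjoint (Ioo (s j) (t j)) (Ioo (s k) (t k))) :
    ∑ k ∈ Finset.range K, (t k - s k) ≤ L := by
  have hpd : Set.PairwiseDisjoint (↑(Finset.range K) : Set ℕ) (fun k ↦ Ioo (s k) (t k)) := by
    intro j hj k hk hjk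
    exact hdisj j (Finset.mem_range.1 hj) k (Finset.mem_range.1 hk) hjk
  have h1 : volume (⋃ k ∈ Finset.range K, Ioo (s k) (t k)) =
      ∑ k ∈ Finset.range K, volume (Ioo (s k) (t k)) :=
    measure_biUnion_finset hpd fun k _ ↦ measurableSet_Ioo
  have h2 : volume (⋃ k ∈ Finset.range K, Ioo (s k) (t k)) ≤ ENNReal.ofReal L := by
    calc volume (⋃ k ∈ Finset.range K, Ioo (s k) (t k)) ≤ volume (Ioc a (a + L)) :=
          measure_mono (iUnion₂_subset fun k hk ↦ hsub k (Finset.mem_range.1 hk))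
      _ = ENNReal.ofReal L := by rw [Real.volume_Ioc]; ring_nf
  rw [h1] at h2
  simp only [Real.volume_Ioo] at h2
  rw [← ENNReal.ofReal_sum_of_nonneg fun k hk ↦ sub_nonneg.2 (hst k (Finset.mem_range.1 hk))]
    at h2
  exact (ENNReal.ofReal_le_ofReal_iff hL).1 h2

/-! ### The theorem -/

section Main

variable {U : Set ℂ} {g : ℂ → ℂ}

/-- The dyadic sub-level sets `U_k = U ∩ g⁻¹(B(c, 2^{k+1} η))`. [folklore] -/
def shellSet (U : Set ℂ) (g : ℂ → ℂ) (c : ℂ) (η : ℝ) (k : ℕ) : Set ℂ :=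
  U ∩ g ⁻¹' ball c (2 ^ (k + 1) * η)

/-- `U_k` is open. [folklore] -/
theorem isOpen_shellSet (hU : IsOpen U) (hg : DifferentiableOn ℂ g U) (c : ℂ) (η : ℝ) (k : ℕ) :
    IsOpen (shellSet U g c η k) :=
  hg.continuousOn.isOpen_inter_preimage hU isOpen_ball

/-- `U_k ⊆ U`. [folklore] -/
theorem shellSet_subset (U : Set ℂ) (g : ℂ → ℂ) (c : ℂ) (η : ℝ) (k : ℕ) : shellSet U g c η k ⊆ U :=
  inter_subset_left

/-- `area g(U_k) ≤ 4π · 4^k η²`. [folklore] -/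
theorem volume_image_shellSet_le (c : ℂ) {η : ℝ} (hη : 0 ≤ η) (k : ℕ) :
    volume (g '' shellSet U g c η k) ≤ ENNReal.ofReal (4 * π * 4 ^ k * η ^ 2) := by
  calc volume (g '' shellSet U g c η k) ≤ volume (ball c (2 ^ (k + 1) * η)) := by
        refine measure_mono ?_
        rintro _ ⟨z, hz, rfl⟩
        exact hz.2
    _ = ENNReal.ofReal (4 * π * 4 ^ k * η ^ 2) := by
        rw [Complex.volume_ball, ← ENNReal.ofReal_pow (by positivity), ← NNReal.coe_real_pi,
          ENNReal.ofReal_coe_nnreal.symm, ← ENNReal.ofReal_mul (by positivity)]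
        congr 1
        have four_pow_eq : (4 : ℝ) ^ k = (2 ^ k) ^ 2 := by
          rw [show (4 : ℝ) = 2 ^ 2 by norm_num, ← pow_mul, mul_comm, pow_mul]
        rw [NNReal.coe_real_pi, four_pow_eq, pow_succ]
        ring

/-- The angular integral is a measurable function of the radius. [folklore] -/
theorem measurable_angSqAt (hU : IsOpen U) (f : ℂ → ℂ) (p : ℂ) :
    Measurable fun r ↦ angSqAt U f p r := by
  have hF : Measurable fun q : ℝ × ℝ ↦ sqDerOn U f (circleMap p q.1 q.2) :=
    (measurable_sqDerOn hU f).comp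
      (show Continuous fun q : ℝ × ℝ ↦ circleMap p q.1 q.2 by unfold circleMap; fun_prop).measurable
  exact hF.lintegral_prod_right' (ν := volume.restrict (Ioo (-π) π))

/-- **The per-circle estimate from a family of shells.** With `a ∈ [-π, π)`, `b ≤ a + 2π`, and
pairwise disjoint parameter intervals `(s k, t k) ⊆ [a, b]`, `k < K`, over which the arc
`x ↦ p + u e^{ix}` lies in `U`, its open part in `U_k`, and the image travels between the
spheres of radii `2^k η` and `2^{k+1} η` about `c`: `η² K²/(2π u²) ≤ ∑_{k<K} 4^{-k} A_k(u)`.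
[cite: PommerenkeBBCM1992, Prop. 2.2] -/
theorem sum_angSqAt_ge_of_shells (hU : IsOpen U) (hg : DifferentiableOn ℂ g U) {c p : ℂ} {η : ℝ}
    (hη : 0 < η) {K : ℕ} {u : ℝ} (hu : 0 < u) {a b : ℝ} (ha : a ∈ Ico (-π) π)
    (hba : b ≤ a + 2 * π) {s t : ℕ → ℝ}
    (hI : ∀ k < K, a ≤ s k ∧ s k < t k ∧ t k ≤ b ∧
      (∀ x ∈ Icc (s k) (t k), circleMap p u x ∈ U) ∧
      (∀ x ∈ Ioo (s k) (t k), circleMap p u x ∈ shellSet U g c η k) ∧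
      ((‖g (circleMap p u (s k)) - c‖ ≤ 2 ^ k * η ∧ 2 ^ (k + 1) * η ≤ ‖g (circleMap p u (t k)) - c‖) ∨
        (‖g (circleMap p u (t k)) - c‖ ≤ 2 ^ k * η ∧ 2 ^ (k + 1) * η ≤ ‖g (circleMap p u (s k)) - c‖)))
    (hdisj : ∀ j < K, ∀ k < K, j ≠ k → Disjoint (Ioo (s j) (t j)) (Ioo (s k) (t k))) :
    ENNReal.ofReal (η ^ 2 * K ^ 2 / (2 * π * u ^ 2)) ≤
      ∑ k ∈ Finset.range K, ENNReal.ofReal ((4 ^ k)⁻¹) * angSqAt (shellSet U g c η k) g p u := by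
  -- the shell integrals
  set X : ℕ → ℝ≥0∞ := fun k ↦ ∫⁻ x in Ioo (s k) (t k), sqDerOn (shellSet U g c η k) g (circleMap p u x)
    with hX
  -- one-shell inequality
  have hshell : ∀ k < K, ENNReal.ofReal ((2 ^ k * η) ^ 2) ≤
      ENNReal.ofReal (u ^ 2 * (t k - s k)) * X k := by
    intro k hk
    obtain ⟨-, hst, -, hmemU, hmemW, hends⟩ := hI k hk
    have h := sq_le_mul_setLIntegral hU hg (isOpen_shellSet hU hg c η k) hu hst.le hmemU hmemW
      (ρ₁ := 2 ^ k * η) (ρ₂ := 2 ^ (k + 1) * η) (by rw [pow_succ]; nlinarith [pow_pos (two_pos (α := ℝ)) k])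
      hends
    rwa [show (2 : ℝ) ^ (k + 1) * η - 2 ^ k * η = 2 ^ k * η by rw [pow_succ]; ring] at h
  -- the angular integral dominates the shell integral
  have hAX : ∀ k < K, X k ≤ angSqAt (shellSet U g c η k) g p u := by
    intro k hk
    obtain ⟨hsa, -, htb, -⟩ := hI k hk
    rw [angSqAt_eq_setLIntegral_Ioc _ _ _ _ (Ico_subset_Icc_self ha)]
    exact lintegral_mono_set fun x hx ↦ ⟨lt_of_le_of_lt hsa hx.1, by linarith [hx.2]⟩
  -- if some shell integral is infinite there is nothing to prove
  by_cases htop : ∃ k < K, X k = ⊤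
  · obtain ⟨k, hk, hXk⟩ := htop
    have : ENNReal.ofReal ((4 ^ k)⁻¹) * angSqAt (shellSet U g c η k) g p u = ⊤ := by
      have hA : angSqAt (shellSet U g c η k) g p u = ⊤ := eq_top_iff.2 (hXk ▸ hAX k hk)
      rw [hA, ENNReal.mul_top]
      exact (ENNReal.ofReal_pos.2 (by positivity)).ne'
    refine le_trans ?_ (Finset.single_le_sum (f := fun k ↦
      ENNReal.ofReal ((4 ^ k)⁻¹) * angSqAt (shellSet U g c η k) g p u) (fun _ _ ↦ bot_le)
      (Finset.mem_range.2 hk))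
    simp only [this, le_top]
  push Not at htop
  -- real shell integrals
  set x : ℕ → ℝ := fun k ↦ (X k).toReal with hx
  have hXeq : ∀ k < K, X k = ENNReal.ofReal (x k) := fun k hk ↦
    (ENNReal.ofReal_toReal (htop k hk)).symm
  -- the real one-shell inequality: `(2^k η)² ≤ u² (t k - s k) x k`
  have hreal : ∀ k < K, (2 ^ k * η) ^ 2 ≤ u ^ 2 * (t k - s k) * x k := by
    intro k hk
    have h := hshell k hk
    rw [hXeq k hk, ← ENNReal.ofReal_mul (by nlinarith [(hI k hk).2.1, sq_nonneg u])] at h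
    exact (ENNReal.ofReal_le_ofReal_iff (by
      have := (hI k hk).2.1
      have : 0 ≤ x k := ENNReal.toReal_nonneg
      positivity)).1 h
  have hlen_pos : ∀ k < K, 0 < t k - s k := fun k hk ↦ sub_pos.2 (hI k hk).2.1
  have hxpos : ∀ k < K, 0 < x k := by
    intro k hk
    have h := hreal k hk
    have h0 : 0 < (2 ^ k * η) ^ 2 := by positivity
    by_contra hle
    push Not at hle
    have : u ^ 2 * (t k - s k) * x k ≤ 0 :=
      mul_nonpos_of_nonneg_of_nonpos (by nlinarith [hlen_pos k hk, sq_nonneg u]) hle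
    linarith
  -- `1/(t k - s k) ≤ u² x k / (4^k η²)`
  have hinv : ∀ k < K, (t k - s k)⁻¹ ≤ u ^ 2 / η ^ 2 * ((4 ^ k)⁻¹ * x k) := by
    intro k hk
    have h := hreal k hk
    rw [mul_pow] at h
    have four_pow_eq : (4 : ℝ) ^ k = (2 ^ k) ^ 2 := by
      rw [show (4 : ℝ) = 2 ^ 2 by norm_num, ← pow_mul, mul_comm, pow_mul]
    rw [four_pow_eq, inv_le_iff_one_le_mul₀ (hlen_pos k hk)]
    have h4 : (0 : ℝ) < (2 ^ k) ^ 2 := by positivity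
    have hη2 : 0 < η ^ 2 := by positivity
    have hkey : (1 : ℝ) ≤ ((2 ^ k) ^ 2 * η ^ 2)⁻¹ * (u ^ 2 * (t k - s k) * x k) := by
      rw [le_inv_mul_iff₀ (by positivity), mul_one]
      exact h
    refine hkey.trans (le_of_eq ?_)
    field_simp
  -- total length of the shells
  have hsum_len : ∑ k ∈ Finset.range K, (t k - s k) ≤ 2 * π :=
    sum_sub_le_of_disjoint (a := a) (by positivity) (fun k hk ↦ (hI k hk).2.1.le)
      (fun k hk y hy ↦ ⟨lt_of_le_of_lt (hI k hk).1 hy.1,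
        by linarith [hy.2, (hI k hk).2.2.1]⟩) hdisj
  -- harmonic–arithmetic mean
  have hHM := sq_card_le_sum_inv_mul_sum hlen_pos
  have hS : (K : ℝ) ^ 2 ≤ (u ^ 2 / η ^ 2 * ∑ k ∈ Finset.range K, (4 ^ k)⁻¹ * x k) * (2 * π) := by
    refine hHM.trans ?_
    have h1 : ∑ k ∈ Finset.range K, (t k - s k)⁻¹ ≤
        u ^ 2 / η ^ 2 * ∑ k ∈ Finset.range K, (4 ^ k)⁻¹ * x k := by
      rw [Finset.mul_sum]
      exact Finset.sum_le_sum fun k hk ↦ hinv k (Finset.mem_range.1 hk)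
    have h0 : 0 ≤ ∑ k ∈ Finset.range K, (t k - s k)⁻¹ :=
      Finset.sum_nonneg fun k hk ↦ (inv_pos.2 (hlen_pos k (Finset.mem_range.1 hk))).le
    have h0' : 0 ≤ ∑ k ∈ Finset.range K, (t k - s k) :=
      Finset.sum_nonneg fun k hk ↦ (hlen_pos k (Finset.mem_range.1 hk)).le
    calc (∑ k ∈ Finset.range K, (t k - s k)⁻¹) * ∑ k ∈ Finset.range K, (t k - s k)
        ≤ (u ^ 2 / η ^ 2 * ∑ k ∈ Finset.range K, (4 ^ k)⁻¹ * x k) *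
            ∑ k ∈ Finset.range K, (t k - s k) := mul_le_mul_of_nonneg_right h1 h0'
      _ ≤ _ := mul_le_mul_of_nonneg_left hsum_len (le_trans h0 h1)
  have hfinal : η ^ 2 * K ^ 2 / (2 * π * u ^ 2) ≤ ∑ k ∈ Finset.range K, (4 ^ k)⁻¹ * x k := by
    rw [div_le_iff₀ (by positivity)]
    have hη2 : 0 < η ^ 2 := by positivity
    have hu2 : 0 < u ^ 2 := by positivity
    have := mul_le_mul_of_nonneg_left hS hη2.le
    calc η ^ 2 * (K : ℝ) ^ 2 ≤ η ^ 2 * ((u ^ 2 / η ^ 2 * ∑ k ∈ Finset.range K, (4 ^ k)⁻¹ * x k) * (2 * π)) := this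
      _ = (∑ k ∈ Finset.range K, (4 ^ k)⁻¹ * x k) * (2 * π * u ^ 2) := by
          field_simp
  -- back to `ℝ≥0∞`
  calc ENNReal.ofReal (η ^ 2 * K ^ 2 / (2 * π * u ^ 2))
      ≤ ENNReal.ofReal (∑ k ∈ Finset.range K, (4 ^ k)⁻¹ * x k) := ENNReal.ofReal_le_ofReal hfinal
    _ = ∑ k ∈ Finset.range K, ENNReal.ofReal ((4 ^ k)⁻¹ * x k) :=
        ENNReal.ofReal_sum_of_nonneg fun k hk ↦
          mul_nonneg (by positivity) (hxpos k (Finset.mem_range.1 hk)).le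
    _ = ∑ k ∈ Finset.range K, ENNReal.ofReal ((4 ^ k)⁻¹) * X k := by
        refine Finset.sum_congr rfl fun k hk ↦ ?_
        rw [ENNReal.ofReal_mul (by positivity), hXeq k (Finset.mem_range.1 hk)]
    _ ≤ ∑ k ∈ Finset.range K, ENNReal.ofReal ((4 ^ k)⁻¹) * angSqAt (shellSet U g c η k) g p u := by
        refine Finset.sum_le_sum fun k hk ↦ ?_
        gcongr
        exact hAX k (Finset.mem_range.1 hk)

/-- **The per-circle estimate.** If the circle `{|z - p| = u}` contains an arc in `U` whose
image joins `{|w - c| ≤ η}` to `{|w - c| ≥ ε}`, `ε ≥ 2^K η`, then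
`η² K² / (2π u²) ≤ ∑_{k<K} 4^{-k} A_k(u)`, `A_k(u)` the angular integral of `‖g'‖² 1_{U_k}`.
[cite: PommerenkeBBCM1992, Prop. 2.2] -/
theorem sum_angSqAt_ge (hU : IsOpen U) (hg : DifferentiableOn ℂ g U) {c p : ℂ} {η ε : ℝ}
    (hη : 0 < η) {K : ℕ} (hKε : 2 ^ K * η ≤ ε) {u : ℝ} (hu : 0 < u) {a b : ℝ} (hab : a ≤ b)
    (hba : b ≤ a + 2 * π) (hmem : ∀ t ∈ Icc a b, circleMap p u t ∈ U)
    (hends : (‖g (circleMap p u a) - c‖ ≤ η ∧ ε ≤ ‖g (circleMap p u b) - c‖) ∨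
      (‖g (circleMap p u b) - c‖ ≤ η ∧ ε ≤ ‖g (circleMap p u a) - c‖)) :
    ENNReal.ofReal (η ^ 2 * K ^ 2 / (2 * π * u ^ 2)) ≤
      ∑ k ∈ Finset.range K, ENNReal.ofReal ((4 ^ k)⁻¹) * angSqAt (shellSet U g c η k) g p u := by
  -- normalise the parameter window: `a ∈ [-π, π)`
  wlog ha : a ∈ Ico (-π) π generalizing a b
  · obtain ⟨n, hn⟩ : ∃ n : ℤ, a - n * (2 * π) ∈ Ico (-π) π := by
      refine ⟨⌊(a + π) / (2 * π)⌋, ?_, ?_⟩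
      · have := Int.floor_le ((a + π) / (2 * π))
        rw [le_div_iff₀ (by positivity)] at this
        linarith
      · have := Int.lt_floor_add_one ((a + π) / (2 * π))
        rw [div_lt_iff₀ (by positivity)] at this
        linarith
    have hper : ∀ t, circleMap p u (t - n * (2 * π)) = circleMap p u t := fun t ↦
      (periodic_circleMap p u).sub_int_mul_eq n
    refine this (a := a - n * (2 * π)) (b := b - n * (2 * π)) (by linarith) (by linarith)
      (fun t ht ↦ ?_) ?_ hn
    · have := hmem (t + n * (2 * π)) ⟨by linarith [ht.1], by linarith [ht.2]⟩
      rwa [show t = t + n * (2 * π) - n * (2 * π) by ring, hper]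
    · rwa [hper, hper]
  -- the levels
  set r : ℕ → ℝ := fun k ↦ 2 ^ k * η with hr_def
  have hr : ∀ k, r k < r (k + 1) := fun k ↦ by
    simp only [hr_def, pow_succ]; nlinarith [pow_pos (two_pos : (0 : ℝ) < 2) k]
  set φ : ℝ → ℝ := fun t ↦ ‖g (circleMap p u t) - c‖ with hφ_def
  have hφc : ContinuousOn φ (Icc a b) :=
    ((hg.continuousOn.comp (continuous_circleMap p u).continuousOn hmem).sub
      continuousOn_const).norm
  have hmem_shell : ∀ k x, x ∈ Icc a b → φ x < r (k + 1) → circleMap p u x ∈ shellSet U g c η k :=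
    fun k x hx hφx ↦ ⟨hmem x hx, by
      rw [mem_preimage, mem_ball, dist_eq_norm]; exact hφx⟩
  rcases hends with ⟨h0, h1⟩ | ⟨h0, h1⟩
  · -- forward orientation
    obtain ⟨s, t, h⟩ := exists_shells hab hφc hr (K := K) (by simpa [hr_def] using h0)
      (by simpa [hr_def] using hKε.trans h1)
    have hchain : ∀ j k, j < k → k < K → t j ≤ s k := by
      intro j k hjk hk
      induction k with
      | zero => exact absurd hjk (Nat.not_lt_zero _)
      | succ k ih =>
        have hk' : k < K := (Nat.lt_succ_self k).trans hk
        rcases Nat.lt_succ_iff_lt_or_eq.1 hjk with hjk' | rfl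
        · exact ((ih hjk' hk').trans (h k hk').2.1.le).trans ((h k hk').2.2.2.2.2.2 hk)
        · exact (h j hk').2.2.2.2.2.2 hk
    refine sum_angSqAt_ge_of_shells hU hg hη hu ha hba (s := s) (t := t) (fun k hk ↦ ?_) ?_
    · obtain ⟨h1', h2', h3', h4', h5', h6', -⟩ := h k hk
      exact ⟨h1', h2', h3', fun x hx ↦ hmem x ⟨h1'.trans hx.1, hx.2.trans h3'⟩,
        fun x hx ↦ hmem_shell k x ⟨h1'.trans hx.1.le, hx.2.le.trans h3'⟩ (h6' x ⟨h1'.trans hx.1.le, hx.2⟩),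
        Or.inl ⟨h4', h5'⟩⟩
    · intro j hj k hk hjk
      rcases lt_or_gt_of_ne hjk with hlt | hgt
      · exact disjoint_left.2 fun x hxj hxk ↦ by
          have := hchain j k hlt hk; linarith [hxj.2, hxk.1]
      · exact disjoint_left.2 fun x hxj hxk ↦ by
          have := hchain k j hgt hj; linarith [hxj.1, hxk.2]
  · -- reversed orientation
    obtain ⟨s, t, h⟩ := exists_shells_rev hab hφc hr (K := K) (by simpa [hr_def] using hKε.trans h1)
      (by simpa [hr_def] using h0)
    have hchain : ∀ j k, j < k → k < K → t k ≤ s j := by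
      intro j k hjk hk
      induction k with
      | zero => exact absurd hjk (Nat.not_lt_zero _)
      | succ k ih =>
        have hk' : k < K := (Nat.lt_succ_self k).trans hk
        rcases Nat.lt_succ_iff_lt_or_eq.1 hjk with hjk' | rfl
        · exact (((h k hk').2.2.2.2.2.2 hk).trans (h k hk').2.1.le).trans (ih hjk' hk')
        · exact (h j hk').2.2.2.2.2.2 hk
    refine sum_angSqAt_ge_of_shells hU hg hη hu ha hba (s := s) (t := t) (fun k hk ↦ ?_) ?_
    · obtain ⟨h1', h2', h3', h4', h5', h6', -⟩ := h k hk
      exact ⟨h1', h2', h3', fun x hx ↦ hmem x ⟨h1'.trans hx.1, hx.2.trans h3'⟩,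
        fun x hx ↦ hmem_shell k x ⟨h1'.trans hx.1.le, hx.2.le.trans h3'⟩ (h6' x ⟨hx.1, hx.2.le.trans h3'⟩),
        Or.inr ⟨h4', h5'⟩⟩
    · intro j hj k hk hjk
      rcases lt_or_gt_of_ne hjk with hlt | hgt
      · exact disjoint_left.2 fun x hxj hxk ↦ by
          have := hchain j k hlt hk; linarith [hxj.1, hxk.2]
      · exact disjoint_left.2 fun x hxj hxk ↦ by
          have := hchain k j hgt hj; linarith [hxj.2, hxk.1]

/-- **Log-scale length–area.** Let `g` be holomorphic and injective on the open set `U`, let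
`0 < η`, `1 ≤ K` and `2^K η ≤ ε`, and let `T ⊆ (0, ∞)` be a measurable set of radii such that
for every `u ∈ T` the circle `{|z - p| = u}` contains an arc (parametrised by `t ↦ p + u e^{it}`
on a window `[a, b]` of length `≤ 2π`) lying in `U` whose image under `g` joins
`{|w - c| ≤ η}` to `{|w - c| ≥ ε}`. Then `∫_T du/u ≤ 8π²/K`: the circles whose images cross the
conformal annulus `{η < |w - c| < ε}` have logarithmic measure `O(1/log(ε/η))`. (The
deterministic core of [LSW04] Lemma 5.4, replacing the conformal invariance of Brownian harmonic
measure; Pommerenke's length–area on `K` dyadic shells.)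
[cite: PommerenkeBBCM1992, Prop. 2.2] -/
theorem lintegral_inv_le_of_crossings (hU : IsOpen U) (hg : DifferentiableOn ℂ g U)
    (hinj : InjOn g U) {c p : ℂ} {η ε : ℝ} (hη : 0 < η) {K : ℕ} (hK : 1 ≤ K)
    (hKε : 2 ^ K * η ≤ ε) {T : Set ℝ} (hTm : MeasurableSet T) (hT0 : T ⊆ Ioi 0)
    (hcross : ∀ u ∈ T, ∃ a b : ℝ, a ≤ b ∧ b ≤ a + 2 * π ∧ (∀ t ∈ Icc a b, circleMap p u t ∈ U) ∧
      ((‖g (circleMap p u a) - c‖ ≤ η ∧ ε ≤ ‖g (circleMap p u b) - c‖) ∨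
        (‖g (circleMap p u b) - c‖ ≤ η ∧ ε ≤ ‖g (circleMap p u a) - c‖))) :
    ∫⁻ u in T, ENNReal.ofReal u⁻¹ ≤ ENNReal.ofReal (8 * π ^ 2 / K) := by
  set W : ℕ → Set ℂ := fun k ↦ shellSet U g c η k with hW
  set w : ℕ → ℝ≥0∞ := fun k ↦ ENNReal.ofReal ((4 ^ k)⁻¹) with hw
  set A : ℝ := η ^ 2 * K ^ 2 / (2 * π) with hA_def
  have hApos : 0 < A := by
    have : (0 : ℝ) < K := by exact_mod_cast hK
    positivity
  -- pointwise on `T`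
  have hpt : ∀ u ∈ T, ENNReal.ofReal A * ENNReal.ofReal u⁻¹ ≤
      ENNReal.ofReal u * ∑ k ∈ Finset.range K, w k * angSqAt (W k) g p u := by
    intro u huT
    have hu : 0 < u := hT0 huT
    obtain ⟨a, b, hab, hba, hmem, hends⟩ := hcross u huT
    have h := sum_angSqAt_ge hU hg hη hKε hu hab hba hmem hends (c := c)
    have hmul : ENNReal.ofReal u * _ ≤ ENNReal.ofReal u * _ := mul_le_mul' le_rfl h
    refine le_trans (le_of_eq ?_) hmul
    rw [← ENNReal.ofReal_mul hApos.le, ← ENNReal.ofReal_mul hu.le]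
    congr 1
    rw [hA_def]
    field_simp
  -- integrate
  have hint : ENNReal.ofReal A * ∫⁻ u in T, ENNReal.ofReal u⁻¹ ≤
      ∑ k ∈ Finset.range K, w k * ∫⁻ u in Ioi (0 : ℝ), ENNReal.ofReal u * angSqAt (W k) g p u := by
    rw [← lintegral_const_mul' _ _ ENNReal.ofReal_ne_top]
    calc ∫⁻ u in T, ENNReal.ofReal A * ENNReal.ofReal u⁻¹
        ≤ ∫⁻ u in T, ENNReal.ofReal u * ∑ k ∈ Finset.range K, w k * angSqAt (W k) g p u :=
          setLIntegral_mono' hTm hpt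
      _ ≤ ∫⁻ u in Ioi (0 : ℝ), ENNReal.ofReal u * ∑ k ∈ Finset.range K, w k * angSqAt (W k) g p u :=
          lintegral_mono_set hT0
      _ = ∫⁻ u in Ioi (0 : ℝ), ∑ k ∈ Finset.range K, w k * (ENNReal.ofReal u * angSqAt (W k) g p u) := by
          refine lintegral_congr fun u ↦ ?_
          rw [Finset.mul_sum]
          refine Finset.sum_congr rfl fun k _ ↦ ?_
          ring
      _ = ∑ k ∈ Finset.range K, ∫⁻ u in Ioi (0 : ℝ), w k * (ENNReal.ofReal u * angSqAt (W k) g p u) := by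
          refine lintegral_finsetSum _ fun k _ ↦ ?_
          have hm : Measurable fun u : ℝ ↦ ENNReal.ofReal u * angSqAt (W k) g p u :=
            ENNReal.measurable_ofReal.mul (measurable_angSqAt (isOpen_shellSet hU hg c η k) g p)
          exact hm.const_mul _
      _ = ∑ k ∈ Finset.range K, w k * ∫⁻ u in Ioi (0 : ℝ), ENNReal.ofReal u * angSqAt (W k) g p u := by
          refine Finset.sum_congr rfl fun k _ ↦ ?_
          rw [lintegral_const_mul' _ _ ENNReal.ofReal_ne_top]
  -- the areas
  have harea : ∀ k, ∫⁻ u in Ioi (0 : ℝ), ENNReal.ofReal u * angSqAt (W k) g p u ≤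
      ENNReal.ofReal (4 * π * 4 ^ k * η ^ 2) := fun k ↦ by
    rw [lintegral_angSqAt_eq_volume (isOpen_shellSet hU hg c η k)
      (hg.mono (shellSet_subset U g c η k)) (hinj.mono (shellSet_subset U g c η k)) p]
    exact volume_image_shellSet_le c hη.le k
  have hsum : ∑ k ∈ Finset.range K, w k * ∫⁻ u in Ioi (0 : ℝ), ENNReal.ofReal u * angSqAt (W k) g p u
      ≤ ENNReal.ofReal (4 * π * η ^ 2 * K) := by
    calc ∑ k ∈ Finset.range K, w k * ∫⁻ u in Ioi (0 : ℝ), ENNReal.ofReal u * angSqAt (W k) g p u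
        ≤ ∑ k ∈ Finset.range K, w k * ENNReal.ofReal (4 * π * 4 ^ k * η ^ 2) :=
          Finset.sum_le_sum fun k _ ↦ mul_le_mul' le_rfl (harea k)
      _ = ∑ k ∈ Finset.range K, ENNReal.ofReal (4 * π * η ^ 2) := by
          refine Finset.sum_congr rfl fun k _ ↦ ?_
          rw [hw, ← ENNReal.ofReal_mul (by positivity)]
          congr 1
          field_simp
      _ = ENNReal.ofReal (4 * π * η ^ 2 * K) := by
          rw [Finset.sum_const, Finset.card_range, nsmul_eq_mul, mul_comm,
            ← ENNReal.ofReal_natCast, ← ENNReal.ofReal_mul (by positivity)]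
  have hmain := hint.trans hsum
  -- divide
  have hdiv : ∫⁻ u in T, ENNReal.ofReal u⁻¹ ≤
      ENNReal.ofReal (4 * π * η ^ 2 * K) / ENNReal.ofReal A := by
    rw [ENNReal.le_div_iff_mul_le (Or.inl (ENNReal.ofReal_pos.2 hApos).ne')
      (Or.inl ENNReal.ofReal_ne_top), mul_comm]
    exact hmain
  refine hdiv.trans (le_of_eq ?_)
  rw [← ENNReal.ofReal_div_of_pos hApos]
  congr 1
  rw [hA_def]
  have hKpos : (0 : ℝ) < K := by exact_mod_cast hK
  field_simp
  ring

end Main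

end LogScaleLengthArea

end Literature.Analysis.Complex
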